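import Summits.QuantumFields.BalabanUV.T4Continuum.Support.VariationalCovariantRegularityScalar
import Summits.QuantumFields.BalabanUV.T4Continuum.Support.VariationalCovariantInterpolant

/-!
# T⁴ programme, spine node NE2 (U1a), lane P2 — leaf REG⁺ of the variational route, file 5: THE `hREG` BINDER FOR LEAF ONE⁺'s OWN
# REGULARITY FUNCTIONAL `VariationalCovariantInterpolant.rho` (leaf-01 gen 2), which IS leaf REG⁺'s `rhoHess` definitionally
# (`t4/skeletons/NE2-t4-ne2-p2.md` v0.8 §2.C / §7 supplier leaf s6; cell `pub-balaban`, NE2 formalisation swarm, leaf prover 09 gen 3)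

HONEST FRAMING (T4-DAG p. 1).  Rung (B)+1 only — NOT infinite volume, NOT a mass gap, NOT Clay.  NE2 is NOT IN PRINT and NOT proved here.
MODEL LEVEL (U(1) phases / unit-modulus transports = DATA); scalar sector; ONE level; WIRING only: `rho = rhoHess` by `rfl`
(`hess N Rc λ = Σ_μ Σ_ν dirU N Rc (D⁺_ν λ) μ` is `Σ_μ Σ_ν nsq (Dir N Rc μ (Dir N Rc ν λ))`), so `VariationalCovariantRegularityScalar.hREG_hess`
(p212747) IS the binder `hREG` of `VariationalCovariantAssemblySqrt.pair_bracket_sqrt` / `scalar_pair_bracket_sqrt` (p212859) for the `ρ` that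
leaf ONE⁺'s `VariationalCovariantOneStepPhys.blockSpin_Q1_le` uses, with `C_R = 2Λ + 2d·(a n²) + d²·(a n²)²·C_P` (UB⁺ constant `Λ`, P⁺ constant
`C_P`, plaquette defect `a` — for the unit-smooth class `a n² ≍ α`, k-UNIFORM).  No `sorry`; axioms standard; no `def … : Prop`; nothing printed
is a hypothesis.  HONEST DEPENDENCY (cell, verbatim): continuum YM on T⁴ ⇐ BetaPertH ∧ nine spine estimates (0/9 proved); BetaPertH ⇐ (D1) ∧
(D4) ∧ CAP+tail; G-an2-4 gates asym, D1 and NE2/3/4.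
-/

noncomputable section

namespace Summit.QuantumFields.BalabanUV.T4Continuum.VariationalCovariantRegularityRho

open Literature.MathematicalPhysics.QuantumFieldTheory.Balaban1983to89.B5Prop11Plancherel (Tor fine unitVec)
open Literature.MathematicalPhysics.QuantumFieldTheory.Balaban1983to89.B5Prop11Lower (nsq)
open Summit.QuantumFields.BalabanUV.T4Continuum.VariationalCovariantScalarPair (Sc qW Qk)
open Summit.QuantumFields.BalabanUV.T4Continuum.VariationalCovariantRegularityScalar (rhoHess rhoLap hREG_hess rhoHess_le)
open Summit.QuantumFields.BalabanUV.T4Continuum.VariationalCovariantInterpolant (rho)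

variable {d : ℕ} (n : ℕ) [NeZero n] (M : Fin d → ℕ) [hM : ∀ μ, NeZero (M μ)]

/-- leaf ONE⁺'s regularity functional IS leaf REG⁺'s `rhoHess` (definitionally). [folklore] -/
theorem rho_eq_rhoHess (Rc : Tor (fine n M) → Fin d → ℂ) (f : Tor (fine n M) → ℂ) : rho n M Rc f = rhoHess n M Rc f := rfl

/-- Bochner in physical units for leaf ONE⁺'s `ρ` (every `f`): `ρ f ≤ 2ρ_Lap f + 2d·(a n²)·Sc f + d²·(a n²)²·qW f`. [folklore] -/
theorem rho_le {Rc : Tor (fine n M) → Fin d → ℂ} (hR1 : ∀ x μ, ‖Rc x μ‖ = 1) {a : ℝ} (ha : 0 ≤ a)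
    (hP : ∀ x μ ν, ‖Rc x μ * Rc (x + unitVec (fine n M) μ) ν - Rc x ν * Rc (x + unitVec (fine n M) ν) μ‖ ≤ a)
    (f : Tor (fine n M) → ℂ) :
    rho n M Rc f ≤ 2 * rhoLap n M Rc f + 2 * d * (a * (n : ℝ) ^ 2) * Sc n M Rc f + (d : ℝ) ^ 2 * (a * (n : ℝ) ^ 2) ^ 2 * qW n M f :=
  rhoHess_le n M hR1 ha hP f

/-- **`hREG` for leaf ONE⁺'s `ρ`** — literally the binder of `pair_bracket_sqrt` / `scalar_pair_bracket_sqrt` (and of the additive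
`pair_bracket` / `scalar_pair_bracket`) at `ρ := VariationalCovariantInterpolant.rho n M Rc`, `C_R := 2Λ + 2d·(a n²) + d²·(a n²)²·C_P`,
under the DATA binders `‖T‖ = 1`, `‖Rc‖ = 1`, plaquette defect `≤ a`, the UB⁺ binder `hUBc` and the P⁺ binder `hPc`. [folklore] -/
theorem hREG_rho {Rc : Tor (fine n M) → Fin d → ℂ} {T : Tor (fine n M) → ℂ} (hT1 : ∀ x, ‖T x‖ = 1)
    (hR1 : ∀ x μ, ‖Rc x μ‖ = 1) {a : ℝ} (ha : 0 ≤ a)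
    (hP : ∀ x μ ν, ‖Rc x μ * Rc (x + unitVec (fine n M) μ) ν - Rc x ν * Rc (x + unitVec (fine n M) ν) μ‖ ≤ a)
    {Λ CP : ℝ} (hΛ : 0 ≤ Λ)
    (hUBc : ∀ μ : Tor M → ℂ, ∃ f, Qk n M T f = μ ∧ Sc n M Rc f ≤ Λ * nsq μ)
    (hPc : ∀ f, qW n M f ≤ CP * (Sc n M Rc f + nsq (Qk n M T f))) :
    ∀ (μ : Tor M → ℂ) (f : Tor (fine n M) → ℂ), Qk n M T f = μ → (∀ g, Qk n M T g = μ → Sc n M Rc f ≤ Sc n M Rc g) →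
      rho n M Rc f ≤ (2 * Λ + 2 * d * (a * (n : ℝ) ^ 2) + (d : ℝ) ^ 2 * (a * (n : ℝ) ^ 2) ^ 2 * CP) * (Sc n M Rc f + nsq μ) :=
  hREG_hess n M hT1 hR1 ha hP hΛ hUBc hPc

end Summit.QuantumFields.BalabanUV.T4Continuum.VariationalCovariantRegularityRho

end
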